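import Summits.QuantumFields.BalabanUV.T4Continuum.Support.NE7TensionEnergyEnd
import Summits.QuantumFields.BalabanUV.T4Continuum.Support.NE7StraightPartOperator
import HarnessLib

/-!
# NE7TensionEnergyTowerGap — THE ENERGY ROAD'S END WITH ONE ANALYTIC HYPOTHESIS: the tension energy of an interior `(j+2)`-level constrained
# minimiser is of the order `N^d·M^d·M^{−6}` as soon as THE TOWER GAP — the ℓ² distance on skew torus 1-forms between the exact straight part
# `M^d•Ad_{cavgIter}∘QbarIter L (j+2) U` and the κ-last comb line sum `TWg M (combFrame U M)` — is at most `δ‖b‖` with `8δ ≤ √λ′`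

Cell `pub-balaban`, rung (B)+1 sub-cell t4, lineage `b2b-balaban-t4-ne7-p1`, generation 63 (CRUX PROVER NE7 #1, ruling e34b3e0c (2)); hunt (h7)
«ENERGY ROAD» — the END of this generation's chain `NE7CombLineSumGramBounds` ((α_S) exact at any unitary background) → `NE7CombLineSumDivergence`
((β_S)) → `NE7TensionKernelPerturbed` ((E3‴)) → `NE7ExactCurrentQbarKernel` (hτS) → `NE7RestrictedOperator` ∕ `NE7SkewTorusForms` ∕ `NE7CombLineSumCoercive`
(packaging) → `NE7TensionEnergyEnd` (capstone modulo an operator `Sq`) → `NE7StraightPartOperator` (`Sq` constructed).  HERE every existential is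
discharged inside the proof (`exists_skewForms`, `exists_combLineSum_clm`, `exists_restrict`, `exists_straightPart_restrict`) and the ONLY analytic
hypothesis left is stated in the tree's vocabulary, def-free: **(TG)** for every torus 1-form `b` of period `M·N` with skew extension,
  `‖resF N (z κ ↦ M^d • Ad_{cavgIter L (j+2) U z κ} (QbarIter L (j+2) U (extF b) z κ) − resF N (TWg M (combFrame U M) (extF b))‖ ≤ δ·‖b‖`,  `8δ ≤ √λ′`,
`λ′ = M^{d−1}·M(M²+2)∕3` — the NE3 C1 tower in ℓ²(torus) (`NE3CombVsTowerEnd.sum_norm_TWc_sub_Ad_QstrIter_sq_le` for `TWc` vs `Ad∘QstrIter`,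
`NE3CovariantLineSumsL2TowerSharp.sqrt_l2sq_ErrIter_le_sharp` for `QstrIter` vs `QbarIter`; relative size `(16d+20)·loopRad + 2KS·radSum∕ρ` against
`√λ′∕(8·M^{d∕2}·M) ≥ ρ^k∕(8√3)`: a class smallness a constant factor beyond `LevelSmall`).  RESULT **`tension_energy_le_of_towerGap`**:
  `Σ_{x∈periodBox (M·N)} Σ_ν nhsNormSq (Σ_μ cDstar U μ B_{·μν}(x)) ≤ 13·N^d·d·(4d·M^d·a·(1+(d+1)(M−1)Ma))²∕λ′ + (7(Λ′+δ)²∕λ′ + 4)·θ₀²`,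
`Λ′² = M^{d−1}M³`, `θ₀ = 12·#Plane·a²·√(d(MN)^d·card n)`; with `a ≤ ε′M^{−2}`: `O(d³ε′²·N^d·M^{d−6} + ε′⁴·…·N^d·M^{d−8}·M^d…)` — (H∃)ᵀ's order.
INTERIORITY (8) (`a < ε(L^{j+2})^{−2}`, B11 Theorem 1 type) remains the hypothesis it is in `critical_of_interior_isMinimiser`.
HONEST FRAMING (page 1): assembly at ONE interior constrained minimiser on a FIXED FINITE torus, rung (B)+1, CONDITIONAL on (TG) and (8); NE7, NE3 NOT
PRINTED in [Balaban1984PropagatorsI]–[Balaban1989LargeFieldII] and NOT PROVED; continuum YM on T⁴ ⇐ BetaPertH ∧ nine spine estimates (0/9 proved);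
BetaPertH ⇐ (D1) ∧ (D4) ∧ CAP+tail; G-an2-4 gates asym, D1 and NE2/3/4; NOT infinite volume, NOT mass gap, NOT Clay.  0 def, 0 sorry.
-/

set_option autoImplicit false

open scoped BigOperators InnerProductSpace Matrix Matrix.Norms.L2Operator
open Finset

namespace Summit.QuantumFields.BalabanUV.T4Continuum.NE7TensionEnergyTowerGap

open Literature.MathematicalPhysics.QuantumFieldTheory.Balaban1983to89
open B7Prop1Explicit B7Prop2Explicit MatrixNorms UnitaryModel
open T4AveragingDeficitWall (IsUnitaryCfg IsSkewDir SmallField Ad flux)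
open T4AveragingDeficitWallBoundary (periodBox IsPeriodicCfg)
open AveragingDeficitMultiLevelPrep (cavgIter LevelSmall)
open MinimalActionSandwich (IsMinimiser)
open MinimalActionRate (sfClass)
open NE3TangentCovariantTower (QbarIter)
open NE3CovariantCalculus (cDstar)
open NE3CovariantLineAdjoint
open NE3HilbertSchmidtTorus
open NE7CombLineSumCoercive (exists_combLineSum_clm)
open NE7RestrictedOperator (exists_restrict opNorm_restrict_sub_le_of_bound)
open NE7SkewTorusForms (exists_skewForms combLineSum_mem)
open NE7StraightPartOperator (exists_straightPart_restrict)
open NE7TensionEnergyEnd (tension_energy_le_end)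

noncomputable section

variable {d : ℕ} {n : Type*} [Fintype n] [DecidableEq n]

/-- **THE ENERGY ROAD'S END, ONE ANALYTIC HYPOTHESIS.**  `U` an interior `(j+2)`-level constrained minimiser of `sfClass d L N ε` (`L, N ≥ 1`,
`SmallField U a`, `0 ≤ a ≤ 1∕4`, `a < ε∕(L^{j+2})²`, `LevelSmall d L (j+1) (ε∕(L^{j+2})²)`), `B` its flux form, `M = L^{j+2}`.  ASSUME THE TOWER GAP (TG):
for every torus 1-form `b` of period `M·N` with skew extension,
`‖resF N (z κ ↦ M^d • Ad_{cavgIter L (j+2) U z κ} (QbarIter L (j+2) U (extF b) z κ)) − resF N (TWg M (combFrame U M) (extF b))‖ ≤ δ‖b‖` with `0 ≤ δ`,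
`8δ ≤ √λ′`.  THEN the tension energy obeys
`Σ_{x∈periodBox (M·N)} Σ_ν nhsNormSq (T_ν(x)) ≤ 13·N^d·d·(2d·M^d·(2a)·(1+(d+1)(M−1)Ma))²∕λ′ + (7(Λ′+δ)²∕λ′ + 4)·θ₀²`. [folklore] -/
theorem tension_energy_le_of_towerGap [Nonempty n] {L N : ℕ} (hL : 1 ≤ L) (hN : 1 ≤ N) {ε a : ℝ} (j : ℕ)
    {V U : Site d → Fin d → (Matrix n n ℂ)ˣ} (hmin : IsMinimiser d (sfClass d L N ε) L N (j + 2) V U)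
    (ha0 : 0 ≤ a) (ha4 : a ≤ 1 / 4) (haε : a < ε / ((L : ℝ) ^ (j + 2)) ^ 2) (hUa : SmallField U a)
    (hls : LevelSmall d L (j + 1) (ε / ((L : ℝ) ^ (j + 2)) ^ 2))
    {B : Site d → Fin d → Fin d → Matrix n n ℂ} (hBF : ∀ (x : Site d) (μ ν : Fin d) (h : μ < ν), B x μ ν = flux U (x, ⟨(μ, ν), h⟩))
    (hanti : ∀ (x : Site d) (μ ν : Fin d), B x ν μ = -B x μ ν)
    [NeZero N] [NeZero (L ^ (j + 2) * N)]
    {δ : ℝ} (hδ0 : 0 ≤ δ) (hδ : 8 * δ ≤ Real.sqrt (((L ^ (j + 2) : ℕ) : ℝ) ^ (d - 1) * (((L ^ (j + 2) : ℕ) : ℝ) * (((L ^ (j + 2) : ℕ) : ℝ) ^ 2 + 2) / 3)))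
    (hTG : ∀ b : Form d n (L ^ (j + 2) * N), IsSkewDir (extF (L ^ (j + 2) * N) b) →
      ‖resF (d := d) N (fun z κ => (((L ^ (j + 2) : ℕ) : ℝ) ^ d) •
            Ad (cavgIter L (j + 2) U z κ) (QbarIter L (j + 2) U (extF (L ^ (j + 2) * N) b) z κ))
        - resF (d := d) N (TWg (L ^ (j + 2)) (combFrame U (L ^ (j + 2))) (extF (L ^ (j + 2) * N) b))‖ ≤ δ * ‖b‖) :
    ∑ x ∈ periodBox (d := d) (L ^ (j + 2) * N), ∑ ν : Fin d, nhsNormSq (∑ μ : Fin d, cDstar U μ (fun y => B y μ ν) x)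
      ≤ 13 * ((N : ℝ) ^ d * d * (2 * d * ((L ^ (j + 2) : ℕ) : ℝ) ^ d * (2 * a)
                * (1 + ((d : ℝ) + 1) * (((L ^ (j + 2) : ℕ) : ℝ) - 1) * ((L ^ (j + 2) : ℕ) : ℝ) * a)) ^ 2)
            / (((L ^ (j + 2) : ℕ) : ℝ) ^ (d - 1) * (((L ^ (j + 2) : ℕ) : ℝ) * (((L ^ (j + 2) : ℕ) : ℝ) ^ 2 + 2) / 3))
        + (7 * (Real.sqrt (((L ^ (j + 2) : ℕ) : ℝ) ^ (d - 1) * ((L ^ (j + 2) : ℕ) : ℝ) ^ 3) + δ) ^ 2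
              / (((L ^ (j + 2) : ℕ) : ℝ) ^ (d - 1) * (((L ^ (j + 2) : ℕ) : ℝ) * (((L ^ (j + 2) : ℕ) : ℝ) ^ 2 + 2) / 3)) + 4)
          * (12 * (Fintype.card (T4AveragingDeficitWall.Plane d) : ℝ) * a ^ 2
              * Real.sqrt (d * (((L ^ (j + 2) * N : ℕ) : ℕ) : ℝ) ^ d * Fintype.card n)) ^ 2 := by
  have hU : IsUnitaryCfg U := hmin.mem.1.1
  have hUP : IsPeriodicCfg U ((L ^ (j + 2) * N : ℕ) : ℤ) := by rw [Nat.mul_comm]; exact hmin.mem.1.2.1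
  have hx : 0 ≤ ε / ((L : ℝ) ^ (j + 2)) ^ 2 := ha0.trans haε.le
  have hUx : SmallField U (ε / ((L : ℝ) ^ (j + 2)) ^ 2) := fun y κ κ' hne => (hUa y κ κ' hne).trans haε.le
  -- the skew torus 1-forms
  obtain ⟨Kf, hKf⟩ := exists_skewForms (d := d) (n := n) (L ^ (j + 2) * N)
  obtain ⟨Kc, hKc⟩ := exists_skewForms (d := d) (n := n) N
  -- the comb line sum and its restriction
  obtain ⟨S', hS'⟩ := exists_combLineSum_clm (d := d) (n := n) (L ^ (j + 2)) N U
  obtain ⟨S'r, hS'r⟩ := exists_restrict S' Kf Kc (combLineSum_mem hU hKf hKc S' hS')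
  -- the exact straight part and its restriction
  obtain ⟨Sq₀, Sq, hSq₀, hSq, hSqker⟩ := exists_straightPart_restrict (N := N) hL j hU hUP hx hls hUx hKf hKc
  -- the tower gap in operator norm on the skew forms
  have hgap : ‖Sq - S'r‖ ≤ δ := by
    refine opNorm_restrict_sub_le_of_bound hSq hS'r hδ0 fun b hb => ?_
    rw [hSq₀ b, hS' b]
    exact hTG b ((hKf b).mp hb)
  exact tension_energy_le_end hL hN j hmin ha0 ha4 haε hUa hls hBF hanti hKf hKc S' hS' S'r hS'r Sq hSqker hδ0 hδ hgap

end

end Summit.QuantumFields.BalabanUV.T4Continuum.NE7TensionEnergyTowerGap
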